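import Summits.Ventures.PercRepro.C025ProfileSimpleReduction
import Summits.Ventures.PercRepro.C025ProfileHallLoop

/-!
# C-033 «SHADOW HALL (H⁺)» — the parallel-pair step at EVERY `q`, and the reduction to SIMPLE matroids (night-3 g7)

`hallIneq_of_delete_parallel_gen`: for a loopless finite matroid with `e ∥ f` and `q ≤ u`, `(H⁺_{q+1,u+1})(M ＼ e)` and
`(H⁺_{q,u})(M ／ e)` give `(H⁺_{q+1,u+1})(M)` — g6's `hallIneq_one_of_delete_parallel` at every `q`: the family fed to
`M ／ e` (`contractFamilyGen`) is the erased members containing `e` together with the members avoiding `e` that are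
rank-`q` sets of `M ／ e` (those with `e ∈ cl B`; at `q = 0` exactly the parallel class); the shadow splits
(`card_shadowLevel_ge_gen`), and the prices are (G1) off that family, (G2) for the erased members and (G3) on it
(C025ProfilePriceGen).

`hallIneq_of_simple_all`: **(H⁺_{q,u}) for every finite matroid and every family follows from (H⁺_{q,u}) for simple
matroids** (all `q < u`): strong induction on `|E|` — a loop: `hallIneq_of_delete_isLoop` (C025ProfileHallLoop); a
parallel pair: the step above (`q = 0`: `profileHall_zero`); otherwise `M` is simple.
-/

open scoped Matroid

namespace PercRepro

open Set Finset ThmH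

section HallSimpleReduction

variable {α : Type} [DecidableEq α] {M : Matroid α} [M.Finite]

/-- The family fed to `M ／ {e}` at rank `q`: the members containing `e`, erased, together with the members avoiding
`e` that are rank-`q` sets of `M ／ {e}`. -/
noncomputable def contractFamilyGen (M : Matroid α) [M.Finite] (e : α) (q : ℕ) (𝒜 : Finset (Finset α)) :
    Finset (Finset α) :=
  (𝒜.filter (fun B => e ∈ B)).image (fun B => B.erase e) ∪
    𝒜.filter (fun B => e ∉ B ∧ B ∈ Profile.Rq (M ／ ({e} : Set α)) q)

/-- The `M ／ {e}`-shadow (level `u`) of `contractFamilyGen` embeds, via `insert e`, into the part of the `M`-shadow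
(level `u+1`) containing `e`. -/
theorem card_contractFamilyGen_shadow_le {e : α} (he : M.Indep {e}) (q u : ℕ) (𝒜 : Finset (Finset α)) :
    (Shadow.shadowLevel (M ／ ({e} : Set α)) u (contractFamilyGen M e q 𝒜)).card ≤
      ((Shadow.shadowLevel M (u + 1) 𝒜).filter (fun S => e ∈ S)).card := by
  have hlev := image_erase_filter_mem_levelSet_eq (M := M) he u
  apply Finset.card_le_card_of_injOn (fun S' => insert e S')
  · intro S' hS'
    rw [Finset.mem_coe, mem_shadowLevel] at hS'
    obtain ⟨hS'lev, B₂, hB₂, hB₂S'⟩ := hS'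
    rw [← hlev, Finset.mem_image] at hS'lev
    obtain ⟨S, hS, rfl⟩ := hS'lev
    rw [Finset.mem_filter] at hS
    rw [Finset.mem_coe, Finset.mem_filter]
    dsimp only
    rw [Finset.insert_erase hS.2, mem_shadowLevel]
    refine ⟨⟨hS.1, ?_⟩, hS.2⟩
    unfold contractFamilyGen at hB₂
    rw [Finset.mem_union, Finset.mem_image, Finset.mem_filter] at hB₂
    rcases hB₂ with ⟨B, hB, rfl⟩ | ⟨hB, _, _⟩
    · rw [Finset.mem_filter] at hB
      refine ⟨B, hB.1, ?_⟩
      intro x hx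
      by_cases hxe : x = e
      · subst hxe; exact hS.2
      · exact (Finset.mem_erase.1 (hB₂S' (Finset.mem_erase.2 ⟨hxe, hx⟩))).2
    · exact ⟨B₂, hB, fun x hx => (Finset.mem_erase.1 (hB₂S' hx)).2⟩
  · intro S₁ hS₁ S₂ hS₂ h
    simp only at h
    rw [Finset.mem_coe, mem_shadowLevel] at hS₁ hS₂
    have h₁ : e ∉ S₁ := by
      intro heS
      have := hS₁.1
      rw [Profile.mem_levelSet, gr_contract_singleton] at this
      exact (Finset.mem_erase.1 (this.1 heS)).1 rfl
    have h₂ : e ∉ S₂ := by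
      intro heS
      have := hS₂.1
      rw [Profile.mem_levelSet, gr_contract_singleton] at this
      exact (Finset.mem_erase.1 (this.1 heS)).1 rfl
    rw [← Finset.erase_insert h₁, ← Finset.erase_insert h₂, h]

/-- The shadow split at a non-loop `e` with the general contraction family. -/
theorem card_shadowLevel_ge_gen {e : α} (he : M.Indep {e}) (q u : ℕ) (𝒜 : Finset (Finset α)) :
    (Shadow.shadowLevel (M ＼ ({e} : Set α)) (u + 1) (𝒜.filter (fun B => e ∉ B))).card +
      (Shadow.shadowLevel (M ／ ({e} : Set α)) u (contractFamilyGen M e q 𝒜)).card ≤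
      (Shadow.shadowLevel M (u + 1) 𝒜).card := by
  rw [← filter_notMem_shadowLevel_eq]
  calc ((Shadow.shadowLevel M (u + 1) 𝒜).filter (fun S => e ∉ S)).card +
        (Shadow.shadowLevel (M ／ ({e} : Set α)) u (contractFamilyGen M e q 𝒜)).card
      ≤ ((Shadow.shadowLevel M (u + 1) 𝒜).filter (fun S => e ∉ S)).card +
        ((Shadow.shadowLevel M (u + 1) 𝒜).filter (fun S => e ∈ S)).card :=
        Nat.add_le_add_left (card_contractFamilyGen_shadow_le he q u 𝒜) _
    _ = (Shadow.shadowLevel M (u + 1) 𝒜).card := by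
        rw [add_comm, Finset.card_filter_add_card_filter_not]

/-- **The parallel-pair step of `(H⁺)` at every `q`**: for a loopless matroid with `e ∥ f` and `q ≤ u`,
`(H⁺_{q+1,u+1})` on `M ＼ {e}` and `(H⁺_{q,u})` on `M ／ {e}` give `(H⁺_{q+1,u+1})` on `M`. -/
theorem hallIneq_of_delete_parallel_gen (hl : ∀ x ∈ M.E, M.IsNonloop x) {e f : α} (hfE : f ∈ M.E) (hfe : f ≠ e)
    (hef : e ∈ M.closure {f}) {q u : ℕ} (hqu : q ≤ u)
    (h1 : Profile.HallIneq (M ＼ ({e} : Set α)) (q + 1) (u + 1)) (h2 : Profile.HallIneq (M ／ ({e} : Set α)) q u) :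
    Profile.HallIneq M (q + 1) (u + 1) := by
  classical
  intro 𝒜 h𝒜
  have heE : e ∈ M.E := M.closure_subset_ground _ hef
  have he : M.Indep {e} := M.indep_singleton.2 (hl e heE)
  have heg : e ∈ gr M := by rw [← Finset.mem_coe, coe_gr]; exact heE
  have hS1 : (Profile.Rq M (q + 1)).filter (fun B => e ∉ B) = Profile.Rq (M ＼ ({e} : Set α)) (q + 1) :=
    filter_notMem_levelSet_eq e (q + 1)
  have hS0 : ((Profile.Rq M (q + 1)).filter (fun B => e ∈ B)).image (fun B => B.erase e) =
      Profile.Rq (M ／ ({e} : Set α)) q := image_erase_filter_mem_levelSet_eq he q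
  have h𝒜₀sub : 𝒜.filter (fun B => e ∉ B) ⊆ Profile.Rq (M ＼ ({e} : Set α)) (q + 1) := by
    rw [← hS1]
    exact Finset.filter_subset_filter _ h𝒜
  have hcf : contractFamilyGen M e q 𝒜 ⊆ Profile.Rq (M ／ ({e} : Set α)) q := by
    unfold contractFamilyGen
    apply Finset.union_subset
    · rw [← hS0]
      exact Finset.image_subset_image (Finset.filter_subset_filter _ h𝒜)
    · intro B hB
      rw [Finset.mem_filter] at hB
      exact hB.2.2
  have hsplit := card_shadowLevel_ge_gen he q u 𝒜
  have h1' := h1 _ h𝒜₀sub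
  have hz := h2 _ hcf
  rw [← Finset.sum_filter_add_sum_filter_not 𝒜 (fun B => e ∈ B)]
  set 𝒜₁ := (𝒜.filter (fun B => e ∈ B)).image (fun B => B.erase e) with h𝒜₁
  set 𝒜P := 𝒜.filter (fun B => e ∉ B ∧ B ∈ Profile.Rq (M ／ ({e} : Set α)) q) with h𝒜P
  set g : Finset α → ℚ := fun B' => Profile.price M (q + 1) (u + 1) (insert e B') with hg
  set pc : Finset α → ℚ := fun B' => Profile.price (M ／ ({e} : Set α)) q u B' with hpc
  -- the members containing e, re-indexed by their erasure
  have hA : ∑ B ∈ 𝒜.filter (fun B => e ∈ B), Profile.price M (q + 1) (u + 1) B = ∑ B' ∈ 𝒜₁, g B' := by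
    rw [h𝒜₁, Finset.sum_image (erase_injOn_filter_mem 𝒜 e)]
    apply Finset.sum_congr rfl
    intro B hB
    simp only [hg]
    rw [Finset.insert_erase (Finset.mem_filter.1 hB).2]
  -- (G2) on the part of 𝒜₁ outside 𝒜P
  have hL2 : ∑ B' ∈ 𝒜₁ \ 𝒜P, g B' ≤ ∑ B' ∈ 𝒜₁ \ 𝒜P, pc B' :=
    Finset.sum_le_sum (fun B' _ => price_insert_le_price_contract_gen he hqu B')
  -- the members avoiding e: equal prices off 𝒜P (G1), the pair bound (G3) on 𝒜P
  have hsubP : 𝒜P ⊆ 𝒜.filter (fun B => e ∉ B) := by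
    intro B hB; rw [h𝒜P, Finset.mem_filter] at hB; rw [Finset.mem_filter]; exact ⟨hB.1, hB.2.1⟩
  have hB : ∑ B ∈ 𝒜.filter (fun B => e ∉ B), Profile.price M (q + 1) (u + 1) B ≤
      ∑ B ∈ 𝒜.filter (fun B => e ∉ B), Profile.price (M ＼ ({e} : Set α)) (q + 1) (u + 1) B +
        (∑ B ∈ 𝒜P, pc B - ∑ B ∈ 𝒜P, g B) := by
    rw [← Finset.sum_sdiff hsubP,
      ← Finset.sum_sdiff (f := fun B => Profile.price (M ＼ ({e} : Set α)) (q + 1) (u + 1) B) hsubP,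
      ← Finset.sum_sub_distrib]
    have hoff : ∀ B ∈ 𝒜.filter (fun B => e ∉ B) \ 𝒜P,
        Profile.price M (q + 1) (u + 1) B = Profile.price (M ＼ ({e} : Set α)) (q + 1) (u + 1) B := by
      intro B hB
      rw [Finset.mem_sdiff] at hB
      have hBd := h𝒜₀sub hB.1
      have hBsub : B ⊆ (gr M).erase e := by
        have := hBd; rw [Profile.mem_Rq, gr_delete_singleton''] at this; exact this.1
      have hB' : B ∉ Profile.Rq (M ／ ({e} : Set α)) q := by
        intro h
        exact hB.2 (by rw [h𝒜P, Finset.mem_filter]; exact ⟨(Finset.mem_filter.1 hB.1).1, (Finset.mem_filter.1 hB.1).2, h⟩)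
      have hcl := notMem_closure_of_notMem_Rq_contract he hBd hB'
      have hfB : f ∉ B := by
        intro hfB
        exact hcl (M.closure_subset_closure (Set.singleton_subset_iff.2 (by exact_mod_cast hfB)) hef)
      have hfX : f ∈ (M.E \ {e}) \ (B : Set α) :=
        ⟨⟨hfE, by rw [Set.mem_singleton_iff]; exact hfe⟩, by rw [Finset.mem_coe]; exact hfB⟩
      exact price_eq_price_delete_of_mem_closure_gen heg _ _ hBsub
        (M.closure_subset_closure (Set.singleton_subset_iff.2 hfX) hef)
    have hP : ∀ B ∈ 𝒜P, Profile.price M (q + 1) (u + 1) B ≤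
        Profile.price (M ＼ ({e} : Set α)) (q + 1) (u + 1) B + (pc B - g B) := by
      intro B hB
      have hBd := h𝒜₀sub (hsubP hB)
      have hBsub : B ⊆ (gr M).erase e := by
        have := hBd; rw [Profile.mem_Rq, gr_delete_singleton''] at this; exact this.1
      have h3 := price_pair_le_gen he hqu hBsub
      simp only [hpc, hg]
      linarith
    rw [Finset.sum_congr rfl hoff]
    have h5 := Finset.sum_le_sum hP
    rw [Finset.sum_add_distrib] at h5
    linarith
  -- bookkeeping of the contraction family
  have hcfsum : ∑ B ∈ contractFamilyGen M e q 𝒜, pc B = ∑ B ∈ 𝒜P, pc B + ∑ B' ∈ 𝒜₁ \ 𝒜P, pc B' := by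
    unfold contractFamilyGen
    rw [← Finset.sum_union Finset.disjoint_sdiff, Finset.union_sdiff_self_eq_union, Finset.union_comm]
  have hdec : ∑ B' ∈ 𝒜₁, g B' = ∑ B' ∈ 𝒜₁ \ 𝒜P, g B' + ∑ B' ∈ 𝒜₁ ∩ 𝒜P, g B' := by
    rw [← Finset.sum_sdiff (f := g) (Finset.inter_subset_left (s₂ := 𝒜P)), Finset.sdiff_inter_self_left]
  have hint : ∑ B' ∈ 𝒜₁ ∩ 𝒜P, g B' ≤ ∑ B ∈ 𝒜P, g B :=
    Finset.sum_le_sum_of_subset_of_nonneg Finset.inter_subset_right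
      (fun B _ _ => Profile.price_nonneg (M := M) (q + 1) (u + 1) (insert e B))
  have hsplit' : ((Shadow.shadowLevel (M ＼ ({e} : Set α)) (u + 1) (𝒜.filter (fun B => e ∉ B))).card : ℚ) +
      ((Shadow.shadowLevel (M ／ ({e} : Set α)) u (contractFamilyGen M e q 𝒜)).card : ℚ) ≤
      ((Shadow.shadowLevel M (u + 1) 𝒜).card : ℚ) := by exact_mod_cast hsplit
  have hz' : ∑ B ∈ contractFamilyGen M e q 𝒜, pc B ≤
      ((Shadow.shadowLevel (M ／ ({e} : Set α)) u (contractFamilyGen M e q 𝒜)).card : ℚ) := hz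
  linarith [hA, hL2, hB, hcfsum, hdec, hint, hz', h1', hsplit']

/-- **(H⁺) for every finite matroid reduces to (H⁺) for simple matroids**: if the Hall inequality `(H⁺_{q,u})` holds
for every simple finite matroid and every `q < u`, it holds for every finite matroid and every `q < u`. -/
theorem hallIneq_of_simple_all
    (hS : ∀ (N : Matroid α) [N.Finite], (∀ T ⊆ N.E, T.encard ≤ 2 → N.Indep T) →
      ∀ q u : ℕ, q < u → Profile.HallIneq N q u)
    (M : Matroid α) [M.Finite] (q u : ℕ) (hqu : q < u) : Profile.HallIneq M q u := by
  suffices h : ∀ n : ℕ, ∀ (N : Matroid α) [N.Finite], (gr N).card = n →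
      ∀ q u : ℕ, q < u → Profile.HallIneq N q u from h _ M rfl q u hqu
  intro n
  induction n using Nat.strong_induction_on with
  | _ n ih =>
  intro N _ hN q u hqu
  by_cases hloop : ∃ ℓ, N.IsLoop ℓ
  · obtain ⟨ℓ, hℓ⟩ := hloop
    have hℓE : ℓ ∈ gr N := by rw [← Finset.mem_coe, coe_gr]; exact hℓ.mem_ground
    apply hallIneq_of_delete_isLoop hℓ
    apply ih ((gr N).erase ℓ).card _ (N ＼ ({ℓ} : Set α)) (by rw [gr_delete_singleton'']) q u hqu
    rw [← hN]; exact Finset.card_erase_lt_of_mem hℓE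
  · have hl : ∀ x ∈ N.E, N.IsNonloop x := fun x hx => N.isNonloop_of_not_isLoop hx (fun h => hloop ⟨x, h⟩)
    by_cases hpar : ∃ e f, f ∈ N.E ∧ f ≠ e ∧ e ∈ N.closure {f}
    · obtain ⟨e, f, hfE, hfe, hef⟩ := hpar
      have heE : e ∈ gr N := by rw [← Finset.mem_coe, coe_gr]; exact N.closure_subset_ground _ hef
      have hlt : ((gr N).erase e).card < n := by rw [← hN]; exact Finset.card_erase_lt_of_mem heE
      rcases Nat.eq_zero_or_pos q with hq0 | hqpos
      · subst hq0
        exact fun 𝒜 h𝒜 => profileHall_zero u h𝒜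
      · obtain ⟨q', rfl⟩ : ∃ q', q = q' + 1 := ⟨q - 1, by omega⟩
        obtain ⟨u', rfl⟩ : ∃ u', u = u' + 1 := ⟨u - 1, by omega⟩
        apply hallIneq_of_delete_parallel_gen hl hfE hfe hef (by omega)
        · exact ih _ hlt (N ＼ ({e} : Set α)) (by rw [gr_delete_singleton'']) (q' + 1) (u' + 1) hqu
        · exact ih _ hlt (N ／ ({e} : Set α)) (by rw [gr_contract_singleton]) q' u' (by omega)
    · push Not at hpar
      exact hS N (simple_of_no_loop_no_parallel hl hpar) q u hqu

end HallSimpleReduction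

end PercRepro
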